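import Mathlib
import Summits.Ventures.HodgeRepro2.T5PropGSkeleton

/-!
# T6N5Signs — the sign algebra of TIER5 §N5.5 (the four [P†]/[A] consequences of Theorem 5.4's
condition (b)), carrier-free

Tier 6 (README §10), sub-step N5 «toric period (R4)» of the M2 discharge (TARGET-T6 §3 row N5, §4 L4;
owners t6-p7 / t6-p8). This file is GLUE: it states, over bare sign data, the elementary consequences
that route/T5-route-2.md §N5.5 draws from condition (b) of Borade–Franzel–Girsch–Yao–Yu–Zelingher
Theorem 5.4 (= TIER5 N5.T1), so that the M2 composition can cite them by name.  Nothing here is a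
displayed hypothesis (no `[cite:` docstring): every printed input (Tate's product formula for the
global root number, Tate's twisting formula, Hilbert reciprocity) enters as an EXPLICIT HYPOTHESIS of
the lemma that uses it, to be discharged at M2 by the displays of the N5 hypothesis file.

The record formalised (TIER5.md §N5 = route/T5-route-2.md v0.21):
* N5.5(b) — S-H is NECESSARY: (a_A) ∧ (a_B) with the same β′ and the same factor force
  (χ_{111}χ_{100})|_Δ = (χ_{101}χ_{110})|_Δ  (`restriction_eq_of_condA`);
* N5.5(c) — (R-sign): (b) at every place for one line ⇒ the global root number of that line
  character is +1, from the product formula ∏_v η_v(λ) = 1 and Tate's ∏_v ε_v = ε (`rsign_of_condB`);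
* N5.5(d) — independence of the auxiliary trace-zero element w: (b) for (λ, δ) ⟺ (b) for (c⁻¹λ, cδ)
  (`condB_twist_iff`);
* N5.5(e) — at every v ∈ S_g (η_v(u) = −1) the two sides cannot share a line character:
  (b_A) ∧ (b_B) at v ⇒ ε_v(ξ_{101}) = −ε_v(ξ_{111}) and ξ_{101,v} ≠ ξ_{111,v}
  (`eps_neg_of_condB_both`, `ne_of_condB_both`);
* N5.5(g) — the (b)-invariance under a twist that leaves every local sign unchanged (`condB_congr`);
* the twist-family choice behind (c): a cofinite-type statement per line (route-3 §G, in kernel as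
  `T5PropGSkeleton.exists_finite_forall_ne_zero`) plus an INFINITE family Ξ_𝔭 give ONE ν with all
  four central values ≠ 0 (`exists_twist_forall_ne_zero`).

Signs live in `ℤˣ` = {±1}; «places» are an arbitrary index type `ι` (the product formulas are stated
with `finprod`, whose finite-support convention is the «almost all factors are +1» of print).

§8(d): uses an L-value-free non-vanishing device: NO.
-/

namespace Summit.Ventures.HodgeRepro2.T6.N5Signs

open scoped BigOperators

/-- In `ℤˣ = {±1}` no element is its own negative. -/
theorem units_ne_neg_self (u : ℤˣ) : u ≠ -u := by
  rcases Int.units_eq_one_or u with rfl | rfl <;> decide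

/-- `ℤˣ` elements are self-inverse. -/
theorem units_inv_eq_self (u : ℤˣ) : u⁻¹ = u := by
  rcases Int.units_eq_one_or u with rfl | rfl <;> decide

/-! ### N5.5(b) — S-H is necessary -/

/-- TIER5 §N5.5(b): «(a_A) and (a_B) have the same left side β′ and the same factor
(ξ′_A⁻²ξ_A)∘j⁻¹, hence (a_A) ∧ (a_B) ⇒ (χ_{111}χ_{100})|_Δ = (χ_{101}χ_{110})|_Δ».  Stated in any
commutative group of characters: the two identities `β = f * rA` and `β = f * rB` force `rA = rB`. -/
theorem restriction_eq_of_condA {G : Type*} [CommGroup G] {β f rA rB : G}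
    (hA : β = f * rA) (hB : β = f * rB) : rA = rB :=
  mul_left_cancel (hA.symm.trans hB)

/-! ### N5.5(c) — the global root number is +1 -/

/-- TIER5 §N5.5(c), one line: if the sign equation (b) `η_v(λ) = ε_v(ξ)` holds at EVERY place `v`,
then the product formula for the quadratic character (`∏_v η_v(λ) = 1`, Hilbert reciprocity for
λ ∈ F^×) and Tate's product formula for the global root number (`∏_v ε_v(ξ) = ε(½, ξ)`) give
`ε(½, ξ) = +1`.  The two product formulas are hypotheses (displays at M2). -/
theorem rsign_of_condB {ι : Type*} (ω ε : ι → ℤˣ) (εglob : ℤˣ)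
    (hb : ∀ v, ω v = ε v) (hω : ∏ᶠ v, ω v = 1) (hε : ∏ᶠ v, ε v = εglob) : εglob = 1 := by
  rw [← hε, ← hω]
  exact finprod_congr fun v => (hb v).symm

/-- Under (b) at every place, the local root numbers have the same (finite) support as the local
symbols: the «almost all factors are +1» convention transfers from one side of (b) to the other. -/
theorem mulSupport_eq_of_condB {ι : Type*} (ω ε : ι → ℤˣ) (hb : ∀ v, ω v = ε v) :
    Function.mulSupport ω = Function.mulSupport ε := by
  ext v
  simp [Function.mem_mulSupport, hb v]

/-- The Finset form of `rsign_of_condB`: if both sides of (b) are +1 outside a finite set `S` of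
places, the product formulas over `S` suffice. -/
theorem rsign_of_condB_finset {ι : Type*} (S : Finset ι) (ω ε : ι → ℤˣ) (εglob : ℤˣ)
    (hb : ∀ v, ω v = ε v) (hω : ∏ v ∈ S, ω v = 1) (hε : ∏ v ∈ S, ε v = εglob) : εglob = 1 := by
  rw [← hε, ← hω]
  exact Finset.prod_congr rfl fun v _ => (hb v).symm

/-! ### N5.5(d) — independence of the auxiliary element w -/

/-- TIER5 §N5.5(d): replacing w by cw multiplies λ_i by c⁻¹ and δ by c; both sides of (b) change by
the same sign `η_v(c)` (multiplicativity of `η_v` on the left, Tate's twisting formula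
ε(½, ξ_v, ψ_{cδ}) = ξ_v(c)·ε(½, ξ_v, ψ_δ) with ξ_v|_{F_v^×} = η_v on the right), so (b) is unchanged.
Stated over the two changed signs `ω' = s * ω`, `ε' = s * ε`. -/
theorem condB_twist_iff (s ω ε : ℤˣ) : s * ω = s * ε ↔ ω = ε :=
  mul_left_cancel_iff

/-- The left side of N5.5(d): for a multiplicative sign character `η_v : Fˣ →* ℤˣ`,
`η_v(c⁻¹ λ) = η_v(c) · η_v(λ)` (signs are self-inverse). -/
theorem omega_inv_mul {F : Type*} [Group F] (η : F →* ℤˣ) (c lam : F) :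
    η (c⁻¹ * lam) = η c * η lam := by
  rw [map_mul, map_inv, units_inv_eq_self]

/-! ### N5.5(e) — the S_g tuning is forced -/

/-- The datum's sign flip at v ∈ S_g: `λ_c = u · λ_a` with `η_v(u) = −1` gives
`η_v(λ_c) = −η_v(λ_a)` (multiplicativity of the local quadratic character). -/
theorem omega_mul_of_neg_one {F : Type*} [Group F] (η : F →* ℤˣ) (u lam : F)
    (hu : η u = -1) : η (u * lam) = -η lam := by
  rw [map_mul, hu, neg_one_mul]

/-- TIER5 §N5.5(e): at a place where the two datum signs are opposite (`ωc = −ωa`), the sign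
equations (b_A): `ωa = ε_v(ξ_a)` and (b_B): `ωc = ε_v(ξ_c)` force opposite local root numbers
`ε_v(ξ_c) = −ε_v(ξ_a)`. -/
theorem eps_neg_of_condB_both {Char : Type*} (epsv : Char → ℤˣ) {ωa ωc : ℤˣ} {ξa ξc : Char}
    (hu : ωc = -ωa) (hA : ωa = epsv ξa) (hB : ωc = epsv ξc) : epsv ξc = -epsv ξa := by
  rw [← hB, ← hA, hu]

/-- TIER5 §N5.5(e), the consequence: «in particular ξ_{101,v} ≠ ξ_{111,v}» — the local root number
is a function of the local character, and opposite values cannot come from equal characters. -/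
theorem ne_of_condB_both {Char : Type*} (epsv : Char → ℤˣ) {ωa ωc : ℤˣ} {ξa ξc : Char}
    (hu : ωc = -ωa) (hA : ωa = epsv ξa) (hB : ωc = epsv ξc) : ξc ≠ ξa := by
  intro h
  have h1 := eps_neg_of_condB_both epsv hu hA hB
  rw [h] at h1
  exact units_ne_neg_self _ h1

/-! ### N5.5(g) — invariance of (b) under a twist that fixes every local sign -/

/-- TIER5 §N5.5(g): if a twist changes no local root number (trivial at the real places, trivial at
every non-split finite place ≠ 𝔭, and (b) vacuous at 𝔭 and at the split places), then (b) holds for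
the twisted family iff it holds for the original one. -/
theorem condB_congr {ι : Type*} (ω ε ε' : ι → ℤˣ) (h : ∀ v, ε' v = ε v) :
    (∀ v, ω v = ε' v) ↔ (∀ v, ω v = ε v) := by
  simp only [h]

/-! ### The twist-family choice behind (c) -/

/-- Route-3 §G (ii) + the infinitude of the family: if each of finitely many branches has only
finitely many bad twists (`T5PropGSkeleton.CofiniteNonvanishing`, in kernel) and the twist family
`Ξ` is INFINITE, then SOME twist `ν` makes every central value `(d i).L ν` non-zero — this is the
choice of the admissible finite parts in [G-N5.1] / TIER5 §N5.8 («for some ν̃ ∈ Ξ_𝔭 in the family»). -/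
theorem exists_twist_forall_ne_zero {Ξ : Type*} {W : Type*} [Ring W] {ι : Type*}
    (hΞ : (Set.univ : Set Ξ).Infinite) (I : Finset ι) (d : ι → T5PropGSkeleton.BranchData Ξ W)
    (hd : ∀ i ∈ I, T5PropGSkeleton.CofiniteNonvanishing (d i)) :
    ∃ ν : Ξ, ∀ i ∈ I, (d i).L ν ≠ 0 := by
  obtain ⟨Z, hZ, hgood⟩ := T5PropGSkeleton.exists_finite_forall_ne_zero I d hd
  obtain ⟨ν, -, hν⟩ := (hΞ.sdiff hZ).nonempty
  exact ⟨ν, hgood ν hν⟩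

/-- The same with the exceptional set made explicit: every `ν` outside the finite union of the
branches' bad sets serves (TIER5 §N5.6 «“infinitely many” ×4 does not intersect, cofinite ×4 does»). -/
theorem forall_ne_zero_of_notMem {Ξ : Type*} {W : Type*} [Ring W] {ι : Type*}
    (I : Finset ι) (d : ι → T5PropGSkeleton.BranchData Ξ W)
    (hd : ∀ i ∈ I, T5PropGSkeleton.CofiniteNonvanishing (d i)) :
    ∃ Z : Set Ξ, Z.Finite ∧ ∀ ν ∉ Z, ∀ i ∈ I, (d i).L ν ≠ 0 :=
  T5PropGSkeleton.exists_finite_forall_ne_zero I d hd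

end Summit.Ventures.HodgeRepro2.T6.N5Signs
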